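import Literature.NumberTheory.Automorphic.NormGroupRelNorm
import HarnessLib

/-!
# The image of the base change `C_K → C_L` of idèle class groups is closed

Topic `NumberTheory/Automorphic`; namespace `Literature.NumberTheory.Automorphic`. Everything here is proved.

For a finite extension of number fields `L/K` (no Galois hypothesis), with `ι = classBaseChange K L :
C_K →* C_L` the base change of idèle class groups (`NormGroupRelNorm.lean`, induced by
`AdeleRing.ideleBaseChange : 𝕀_K → 𝕀_L`):

* `continuous_classBaseChange` — `ι` is continuous;
* `classBaseChange_posRealIdele` — `ι [z_K(t)] = [z_L(t)]` on the classes of the positive real idèles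
  (`AdeleRing.ideleBaseChange_posRealIdele`); `classBaseChange_posReal` — `ι(Γ_K) = Γ_L` (`Γ = posReal`);
* `range_classBaseChange_eq` — `ι(C_K) = ι(C_K¹) · Γ_L` (from `C_K = C_K¹ · Γ_K`,
  `IdeleClassGroup.exists_normOne_mul_posRealIdele`);
* `isClosed_range_classBaseChange` — **`ι(C_K)` is a closed subgroup of `C_L`**: `ι(C_K¹)` is compact
  (`C_K¹` compact — Cassels–Fröhlich II §16, the tree's `IdeleClassGroup.isCompact_normOne_holds` — and `ι`
  continuous), and `A · Γ_L` is closed for compact `A` (`isClosed_mul_posReal`, the norm-one retraction).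

This is the "closed subgroup `𝔸^×_{L₀}L^×/L^×` (the image of the idele class group of `L₀`, which injects
continuously and properly: norm-one classes are compact …)" of PerL v5 §3.2 ll. 310–311 in tree vocabulary; it is
the tree-vocabulary form of `NumberField.isClosed_range_classBaseChange` of the `pub-hodgecm` package
(`HodgeCM/Literature/ClassBaseChange.lean`, gen 5, gate run 24), re-proved WITHOUT the log-norm identity
`|ι c|_L = |c|_K^{[L:K]}` (not needed for closedness). Injectivity for `L/K` Galois is
`IdeleClassBaseChangeInjective.lean`. Not here: properness of `ι` as a map and the norm identity.

## References

* J. W. S. Cassels, A. Fröhlich (eds.), *Algebraic Number Theory* (1967), Ch. II §14 (adèles under base change),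
  §16 (compactness of `J¹/k^×`). [CasselsFrohlichANT1967]
* J. Neukirch, *Algebraic Number Theory*, Part III (7.8) (proof: image of the compact `C⁰` is closed, `× Γ`).
  [Neukirch2013]
-/

noncomputable section

open NumberField
open scoped NNReal Pointwise

namespace Literature.NumberTheory.Automorphic

variable (K L : Type) [Field K] [Field L] [Algebra K L] [NumberField K] [NumberField L]

/-- `ι : C_K → C_L` is continuous (`continuous_ideleBaseChange` through the quotient maps). [folklore] -/
theorem continuous_classBaseChange : Continuous (classBaseChange K L) :=
  (QuotientGroup.isQuotientMap_mk (GaloisRepresentations.principalIdeles K)).continuous_iff.mpr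
    (QuotientGroup.continuous_mk.comp (continuous_ideleBaseChange K L))

/-- `ι [z_K(t)] = [z_L(t)]` for the positive real idèles. [folklore] -/
theorem classBaseChange_posRealIdele (t : ℝ≥0ˣ) :
    classBaseChange K L ((posRealIdele K t : GaloisRepresentations.ideleGroup K) : IdeleClassGroup K) =
      ((posRealIdele L t : GaloisRepresentations.ideleGroup L) : IdeleClassGroup L) := by
  rw [classBaseChange_mk, AdeleRing.ideleBaseChange_posRealIdele]

/-- `ι(Γ_K) = Γ_L` for the subgroups of classes of positive real idèles. [folklore] -/
theorem classBaseChange_posReal :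
    (IdeleClassGroup.posReal K).map (classBaseChange K L) = IdeleClassGroup.posReal L := by
  ext y
  constructor
  · rintro ⟨_, ⟨_, ⟨t, rfl⟩, rfl⟩, rfl⟩
    change classBaseChange K L ((posRealIdele K t : GaloisRepresentations.ideleGroup K) : IdeleClassGroup K) ∈ _
    rw [classBaseChange_posRealIdele]
    exact IdeleClassGroup.posRealIdele_mem_posReal L t
  · rintro ⟨_, ⟨t, rfl⟩, rfl⟩
    refine ⟨((posRealIdele K t : GaloisRepresentations.ideleGroup K) : IdeleClassGroup K),
      IdeleClassGroup.posRealIdele_mem_posReal K t, ?_⟩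
    exact classBaseChange_posRealIdele K L t

/-- **`ι(C_K) = ι(C_K¹) · Γ_L`** (`C_K = C_K¹ · Γ_K` and `ι(Γ_K) = Γ_L`). [cite: Neukirch2013, Part III (7.8) (proof)] -/
theorem range_classBaseChange_eq :
    Set.range (classBaseChange K L) =
      classBaseChange K L '' (IdeleClassGroup.normOne K : Set (IdeleClassGroup K)) *
        (IdeleClassGroup.posReal L : Set (IdeleClassGroup L)) := by
  ext y
  constructor
  · rintro ⟨c, rfl⟩
    obtain ⟨c₁, hc₁, t, rfl⟩ := IdeleClassGroup.exists_normOne_mul_posRealIdele K c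
    refine ⟨classBaseChange K L c₁, ⟨c₁, hc₁, rfl⟩, _, IdeleClassGroup.posRealIdele_mem_posReal L t, ?_⟩
    rw [map_mul, classBaseChange_posRealIdele]
  · rintro ⟨_, ⟨c₁, _, rfl⟩, _, ⟨_, ⟨t, rfl⟩, rfl⟩, rfl⟩
    refine ⟨c₁ * ((posRealIdele K t : GaloisRepresentations.ideleGroup K) : IdeleClassGroup K), ?_⟩
    rw [map_mul, classBaseChange_posRealIdele]
    rfl

/-- **The image of `C_K → C_L` is closed** (`ι(C_K¹)` compact since `C_K¹` is compact and `ι` continuous;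
`A · Γ_L` closed for compact `A`). [cite: CasselsFrohlichANT1967, Ch. II §16] -/
theorem isClosed_range_classBaseChange : IsClosed (Set.range (classBaseChange K L)) := by
  rw [range_classBaseChange_eq]
  exact isClosed_mul_posReal L
    ((IdeleClassGroup.isCompact_normOne_holds K).image (continuous_classBaseChange K L))

/-- The image of `C_K → C_L` as a CLOSED subgroup of `C_L`. [cite: CasselsFrohlichANT1967, Ch. II §16] -/
theorem isClosed_coe_range_classBaseChange :
    IsClosed ((classBaseChange K L).range : Set (IdeleClassGroup L)) := by
  rw [MonoidHom.coe_range]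
  exact isClosed_range_classBaseChange K L

end Literature.NumberTheory.Automorphic

end
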